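import Summits.BirchSwinnertonDyer.Rank1Residual.X4.KuriharaTestFunctions
import HarnessLib

/-!
# Test functions for lemma S, part 2: a point of exact denominator `E ≠ D` lies on no unit coset `x/D + ℤ`, so `γ_{D,g}` vanishes there (cell `b2b-bsdres`, seat additive-p4 gen 30, line V51′ — brick S2′ of lemma S)

HONEST FRAMING (verbatim, cell `b2b-bsdres`): the goal of the cell is to DELETE the COMBINATION-SHAPED
residual classes for ALL analytic-rank `≤ 1` curves over `ℚ` — "full BSD formula for every rank `≤ 1`
curve in class `C`" assembled STRICTLY from published theorems — so that the rank-`≤ 1` remainder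
becomes exactly the CONSTRUCTION-SHAPED classes, which are TYPED (missing-input Props), NOT attempted;
this is not "finishing BSD". This file: research-route KERNEL LEMMAS (pure arithmetic; no named fact,
no conjecture, nothing booked; X4 stays CONSTRUCTION-SHAPED).

## What is proved (and why)

Brick S3 of lemma S evaluates the derivative family of the test function `γ_{D,g}` (`unitPointFun`,
part 1) at points `a/m` with `a` a unit mod `m`; every evaluation point met has an EXACT denominator,
and `γ_{D,g}` must be seen to vanish unless that denominator is `D`. This file proves the arithmetic:

* `eq_of_unit_div_add_int_eq` — if `y/E + z = x/D + z'` with `y` a unit mod `E`, `x` a unit mod `D`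
  (`D, E ≥ 1`), then `E = D`.
* `unitPointFun_apply_unit_div_of_ne` — hence `γ_{D,g}(y/E + z) = 0` for every unit `y` mod `E ≠ D`.

## References

* M. Kurihara, Contrib. Math. Comput. Sci. 7 (2014) 317–356, §1.1. [cite: Kurihara2014, §1.1]
-/

noncomputable section

open scoped MatrixGroups ModularForm Classical

open CongruenceSubgroup Finset

open Literature.NumberTheory.EllipticCurves Literature.NumberTheory.EllipticCurves.ModularForms

namespace Summit.BirchSwinnertonDyer.Rank1Residual.LevelLowering

variable {R : Type*} [CommRing R]

/-- **Distinct exact denominators give disjoint unit cosets**: if `y/E + z = x/D + z'` in `ℚ` with `y` a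
unit of `ℤ/E` and `x` a unit of `ℤ/D` (`D, E ≥ 1`), then `E = D`. (`ED ∣ yD − xE`, so `E ∣ yD` and
`D ∣ xE`; coprimality gives `E ∣ D ∣ E`.) [folklore] -/
theorem eq_of_unit_div_add_int_eq {D E : ℕ} [NeZero D] [NeZero E] (x : (ZMod D)ˣ) (y : (ZMod E)ˣ)
    {z z' : ℤ} (h : (((y : ZMod E).val : ℚ) / E) + z = (((x : ZMod D).val : ℚ) / D) + z') : E = D := by
  have hD : 0 < D := Nat.pos_of_ne_zero (NeZero.ne D)
  have hE : 0 < E := Nat.pos_of_ne_zero (NeZero.ne E)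
  have hDQ : (D : ℚ) ≠ 0 := by exact_mod_cast hD.ne'
  have hEQ : (E : ℚ) ≠ 0 := by exact_mod_cast hE.ne'
  -- clear denominators: y·D + z·E·D = x·E + z'·E·D
  have hZ : ((y : ZMod E).val : ℤ) * D - ((x : ZMod D).val : ℤ) * E = (z' - z) * E * D := by
    have hq : (((y : ZMod E).val : ℚ)) * D - ((x : ZMod D).val : ℚ) * E = ((z' : ℚ) - z) * E * D := by
      field_simp at h
      linarith
    exact_mod_cast hq
  have hcopy : Nat.Coprime (y : ZMod E).val E := ZMod.val_coe_unit_coprime y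
  have hcopx : Nat.Coprime (x : ZMod D).val D := ZMod.val_coe_unit_coprime x
  -- `E ∣ y·D`, hence `E ∣ D`
  have hE_dvd : (E : ℤ) ∣ ((y : ZMod E).val : ℤ) * D := by
    have : (E : ℤ) ∣ ((y : ZMod E).val : ℤ) * D - ((x : ZMod D).val : ℤ) * E := by
      rw [hZ]; exact ⟨(z' - z) * D, by ring⟩
    have h2 : (E : ℤ) ∣ ((x : ZMod D).val : ℤ) * E := dvd_mul_left _ _
    simpa using dvd_add this h2
  have hED : E ∣ D := by
    have : (E : ℤ) ∣ (D : ℤ) := by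
      have hc : IsCoprime (E : ℤ) ((y : ZMod E).val : ℤ) :=
        Nat.isCoprime_iff_coprime.mpr hcopy.symm
      exact hc.dvd_of_dvd_mul_left hE_dvd
    exact_mod_cast this
  -- `D ∣ x·E`, hence `D ∣ E`
  have hD_dvd : (D : ℤ) ∣ ((x : ZMod D).val : ℤ) * E := by
    have : (D : ℤ) ∣ ((y : ZMod E).val : ℤ) * D - ((x : ZMod D).val : ℤ) * E := by
      rw [hZ]; exact ⟨(z' - z) * E, by ring⟩
    have h2 : (D : ℤ) ∣ ((y : ZMod E).val : ℤ) * D := dvd_mul_left _ _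
    have h3 := dvd_sub h2 this
    simpa using h3
  have hDE : D ∣ E := by
    have : (D : ℤ) ∣ (E : ℤ) := by
      have hc : IsCoprime (D : ℤ) ((x : ZMod D).val : ℤ) :=
        Nat.isCoprime_iff_coprime.mpr hcopx.symm
      exact hc.dvd_of_dvd_mul_left hD_dvd
    exact_mod_cast this
  exact Nat.dvd_antisymm hED hDE

/-- **`γ_{D,g}` vanishes on the unit cosets of any other exact denominator**: for `y` a unit of `ℤ/E`
with `E ≠ D`, `γ_{D,g}(y/E + z) = 0`. [folklore] -/
theorem unitPointFun_apply_unit_div_of_ne {D E : ℕ} [NeZero D] [NeZero E] (hED : E ≠ D)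
    (g : (ZMod D)ˣ → R) (y : (ZMod E)ˣ) (z : ℤ) :
    unitPointFun D g ((((y : ZMod E).val : ℚ) / E) + z) = 0 := by
  refine unitPointFun_eq_zero_of_forall g fun x z' h ↦ hED ?_
  exact eq_of_unit_div_add_int_eq x y h

end Summit.BirchSwinnertonDyer.Rank1Residual.LevelLowering

end
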